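import Literature.NumberTheory.GelbartRogawski1991.LocalDoubledUnitaryDatum
import Literature.RepresentationTheory.HeisenbergGroup.MetaplecticSumStripping
import Literature.NumberTheory.Automorphic.UnitaryGroupDirectSum
import HarnessLib

-- buildfix G11b-3 recipe (LEDGER B13-1/B13-3), as in the GelbartRogawski1991 siblings: elaborate sequentially so the
-- trailing `attribute [implicit_reducible]` block is in force at `.olean` export (inert for the kernel).
set_option Elab.async false

/-!
# Local undoubling: from a splitting of the doubled group `U(𝕍 ⊕ −𝕍)(F_v)` to a splitting of `U(𝕍)(F_v)`

[GelbartRogawski1991, §3.1 Prop. 3.1.1 p. 455] (by doubling, [Kudla1994, Thm. 3.1]; [HarrisKudlaSweet1996, §1]) at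
ONE finite place `v`: the local splittings of the tree (`LocalSplittingDatum`, `localSplittingDatumCM`) are
constructed for the DOUBLED group `H = U(T₀ ⊕ −T₀)(F_v)`, where the Siegel parabolic exists. This file restricts
them to `U(T₀)(F_v) × 1 ⊂ H` and STRIPS the second variables:

* §1 `U(T₀)(F_v) →* H(F_v)`, `g ↦ g ⊕ 1`: on the matrix form `«local»` (`inlLocal`, the tree's `blockDiagFin` at
  `(g, 1)` — the local form matrix of `J^𝔻 = (T₀ ⊕ −T₀) ⊗ 1` IS `(T₀ ⊗ 1) ⊕ᶠ (−T₀ ⊗ 1)`, `local_doubled_eq`) and on the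
  factor form `localPi` (`inlLoc`, continuous, components `reindex (g_w ⊕ 1)`, carrying `U(T₀)(𝒪_v)` into `H(𝒪_v)`);
* §2 **`ι^𝔻_v(g ⊕ 1) = ι_v(g) ⊕ 1`** (`iota_inlLoc`): the embedding of the doubled group into `Sp(𝕎^𝔻_v)` restricted to
  `U(T₀) × 1` is the tree's `spInl (e₂ n)` of the embedding of `U(T₀)` into `Sp(𝕎_v)` — `Res(g ⊕ 1) = Res g ⊕ 1`
  (`IsQuadraticCoordinates.resAut_blockDiagGL` / `resAut_reindexGL`);
* §3 **`undoubleLoc s`**: a homomorphism `s : H(F_v) →* S̃p(𝕎^𝔻_v)` over `ι^𝔻_v` (e.g. `D.localSplitting` of a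
  `LocalSplittingDatum` at the doubled datum) yields `undoubleLoc s : U(T₀)(F_v) →* S̃p(𝕎_v)` OVER `ι_v`
  (`proj_undoubleLoc`), with `ω(s(g ⊕ 1))(f₁ ⊠ f₂) = ω(undoubleLoc s g) f₁ ⊠ f₂` (`toRep_undoubleLoc_boxSB`) — the LOCAL
  sum-stripping `HeisenbergGroup/MetaplecticSumStripping` on `𝒮(F_v^{n+n}) = 𝒮(F_v^n) ⊗ 𝒮(F_v^n)`; smooth vectors and
  fixed vectors transfer (`exists_open_forall_toRep_undoubleLoc_eq`, `toRep_undoubleLoc_unitVec`,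
  `1_{𝒪^{n+n}} = 1_{𝒪^n} ⊠ 1_{𝒪^n}`).

Topic `NumberTheory/GelbartRogawski1991`; namespace `Literature.NumberTheory.GelbartRogawski1991.UnitaryDualPair.LocalSplitting`
(that of `LocalUnitarySplittingDatum`). KERNEL MATHEMATICS ONLY: definitions with bodies + theorems; no named fact, no
`sorry`. Written for the `FinLocalSplittings` of an UNDOUBLED unitary group (`LocalUnitarySplittingsCM`).

## References
* [GelbartRogawski1991] S. Gelbart, J. Rogawski, Invent. Math. 105 (1991), §3.1 Prop. 3.1.1 p. 455.
* [Kudla1994] S. Kudla, Israel J. Math. 87 (1994), Thm. 3.1.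
* [HarrisKudlaSweet1996] M. Harris, S. Kudla, W. Sweet, J. AMS 9 (1996), §1 (1.9)–(1.11).
* [MoeglinVignerasWaldspurger1987] LNM 1291 (1987), Chap. 2 II.1 Rem. (6).

## Provenance

LEAN-IN-TREE rule, pub-hodgecm stage-1 cell, seat GR-1 ≡ own-real34 (gen 15).
-/

set_option autoImplicit false

noncomputable section

open NumberField IsDedekindDomain Matrix
open Literature.RepresentationTheory.HeisenbergGroup
open Literature.NumberTheory.Automorphic Literature.NumberTheory.Weil1964

namespace Literature.NumberTheory.GelbartRogawski1991.UnitaryDualPair.LocalSplitting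

variable (F : Type) [Field F] [NumberField F] (E : Type) [Field E] [NumberField E] [Algebra F E] (c : E ≃ₐ[F] E)
  (v : HeightOneSpectrum (𝓞 F)) (n : ℕ) {T₀ : Matrix (Fin n) (Fin n) F}
  {J : Matrix (Fin n) (Fin n) E} (hJ : J = T₀.map (algebraMap F E))
  {JD : Matrix (Fin (n + n)) (Fin (n + n)) E} (hJD : JD = (gramD F n T₀).map (algebraMap F E))

local notation "Fv" => v.adicCompletion F
set_option quotPrecheck false in
/-- the local form matrix `(T₀ ⊗ F_v) ⊗ 1 ∈ M_n(E ⊗ F_v)` of `J`. -/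
local notation "H₁" => Matrix.map (localGram F n T₀ v) (UnitaryGroup.toLocalRing E v)
set_option quotPrecheck false in
/-- the local form matrix `(−T₀ ⊗ F_v) ⊗ 1` of `−J`. -/
local notation "H₂" => Matrix.map (-(localGram F n T₀ v)) (UnitaryGroup.toLocalRing E v)
set_option quotPrecheck false in
/-- `ψ_v` is locally constant. -/
local notation "hlv" => isLocallyConstant_of_isContinuousNontrivial (isContinuousNontrivial_adeleAddCharAt F v)
set_option quotPrecheck false in
/-- `ψ_v` is continuous and non-trivial. -/
local notation "hψv" => isContinuousNontrivial_adeleAddCharAt F v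

/-! ## §1 `U(T₀)(F_v) →* U(T₀ ⊕ −T₀)(F_v)`, `g ↦ g ⊕ 1` -/

include hJ in
/-- `U(J)(F_v)` (matrix form) is the unitary group of the local form matrix `(T₀ ⊗ F_v) ⊗ 1`.
[cite: GelbartRogawski1991, §3.1 p. 454] -/
theorem local_eq : UnitaryGroup.«local» E c n J v = unitaryGroupOfForm (UnitaryGroup.conjLocal E c v) H₁ := by
  rw [UnitaryGroup.«local», UnitaryGroup.localForm_eq_map E n v T₀ hJ]

include hJD in
/-- **the local form matrix of `J^𝔻` is `(T₀ ⊗ 1) ⊕ᶠ (−T₀ ⊗ 1)`**: `U(J^𝔻)(F_v)` (matrix form) is the unitary group of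
`finSum n n H₁ H₂`. [cite: HarrisKudlaSweet1996, §1 (1.9)] -/
theorem local_doubled_eq :
    UnitaryGroup.«local» E c (n + n) JD v =
      unitaryGroupOfForm (UnitaryGroup.conjLocal E c v) (UnitaryGroup.finSum n n H₁ H₂) := by
  rw [UnitaryGroup.«local», UnitaryGroup.localForm_eq_map E (n + n) v (gramD F n T₀) hJD]
  change unitaryGroupOfForm _ ((localGram F (n + n) (gramD F n T₀) v).map _) = _
  rw [localGram_gramD, UnitaryGroup.finSum, UnitaryGroup.reindex_map, UnitaryGroup.fromBlocks_diag_map]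

/-- **`U(J)(F_v) →* U(J^𝔻)(F_v)`, `g ↦ g ⊕ 1`, on the matrix forms** (the tree's `blockDiagFin` at `(g, 1)`,
transported along `local_eq` / `local_doubled_eq`). [cite: GelbartRogawski1991, §3.1 Prop. 3.1.1 p. 455 L1–3] -/
def inlLocal : UnitaryGroup.«local» E c n J v →* UnitaryGroup.«local» E c (n + n) JD v where
  toFun g := ⟨UnitaryGroup.reindexGL (e₂ n) (UnitaryGroup.blockDiagGL ((g : GL (Fin n) (UnitaryGroup.LocalRing E v)), 1)), by
    have hg : (g : GL (Fin n) (UnitaryGroup.LocalRing E v)) ∈ unitaryGroupOfForm (UnitaryGroup.conjLocal E c v) H₁ := by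
      rw [← local_eq F E c v n hJ]; exact g.2
    rw [local_doubled_eq F E c v n hJD, UnitaryGroup.finSum]
    exact (UnitaryGroup.reindexGL_mem_iff _ _ _ _).2 (UnitaryGroup.blockDiagGL_mem _ hg (one_mem _))⟩
  map_one' := Subtype.ext (by
    change UnitaryGroup.reindexGL (e₂ n) (UnitaryGroup.blockDiagGL
      ((((1 : UnitaryGroup.«local» E c n J v) : UnitaryGroup.«local» E c n J v) : GL (Fin n) (UnitaryGroup.LocalRing E v)), 1)) =
      (((1 : UnitaryGroup.«local» E c (n + n) JD v) : UnitaryGroup.«local» E c (n + n) JD v) :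
        GL (Fin (n + n)) (UnitaryGroup.LocalRing E v))
    rw [OneMemClass.coe_one, OneMemClass.coe_one, ← Prod.one_eq_mk, map_one, map_one])
  map_mul' g g' := Subtype.ext (by
    change UnitaryGroup.reindexGL (e₂ n) (UnitaryGroup.blockDiagGL
      (((g * g' : UnitaryGroup.«local» E c n J v) : GL (Fin n) (UnitaryGroup.LocalRing E v)), 1)) =
      UnitaryGroup.reindexGL (e₂ n) (UnitaryGroup.blockDiagGL ((g : GL (Fin n) (UnitaryGroup.LocalRing E v)), 1)) *
        UnitaryGroup.reindexGL (e₂ n) (UnitaryGroup.blockDiagGL ((g' : GL (Fin n) (UnitaryGroup.LocalRing E v)), 1))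
    rw [Subgroup.coe_mul, ← map_mul, ← map_mul, Prod.mk_mul_mk, mul_one])

/-- matrix of `inlLocal g`: `reindex e₂ e₂ (g ⊕ 1)`. [cite: GelbartRogawski1991, §3.1 Prop. 3.1.1 p. 455 L1–3] -/
@[simp] theorem coe_inlLocal (g : UnitaryGroup.«local» E c n J v) :
    ((inlLocal F E c v n hJ hJD g : UnitaryGroup.«local» E c (n + n) JD v) : GL (Fin (n + n)) (UnitaryGroup.LocalRing E v)) =
      UnitaryGroup.reindexGL (e₂ n) (UnitaryGroup.blockDiagGL ((g : GL (Fin n) (UnitaryGroup.LocalRing E v)), 1)) :=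
  rfl

/-- `inlLocal` is continuous. [cite: GelbartRogawski1991, §3.1 Prop. 3.1.1 p. 455 L1–3] -/
theorem continuous_inlLocal : Continuous (inlLocal F E c v n hJ hJD) := by
  refine Continuous.subtype_mk ?_ _
  exact (UnitaryGroup.continuous_reindexGL (e₂ n)).comp
    (UnitaryGroup.continuous_blockDiagGL.comp (continuous_subtype_val.prodMk continuous_const))

/-- **`U(J)(F_v) →* U(J^𝔻)(F_v)`, `g ↦ g ⊕ 1`, on the factor forms `localPi`** (through `localPiEquiv`).
[cite: GelbartRogawski1991, §3.1 Prop. 3.1.1 p. 455 L1–3] -/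
def inlLoc : UnitaryGroup.localPi E c n J v →* UnitaryGroup.localPi E c (n + n) JD v :=
  ((UnitaryGroup.localPiEquiv E c (n + n) JD v).symm.toMonoidHom.comp (inlLocal F E c v n hJ hJD)).comp
    (UnitaryGroup.localPiEquiv E c n J v).toMonoidHom

/-- unfolding: `localPiEquiv (inlLoc g) = inlLocal (localPiEquiv g)`. [cite: GelbartRogawski1991, §3.1 Prop. 3.1.1 p. 455 L1–3] -/
theorem localPiEquiv_inlLoc (g : UnitaryGroup.localPi E c n J v) :
    UnitaryGroup.localPiEquiv E c (n + n) JD v (inlLoc F E c v n hJ hJD g) =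
      inlLocal F E c v n hJ hJD (UnitaryGroup.localPiEquiv E c n J v g) := by
  rw [inlLoc, MonoidHom.comp_apply, MonoidHom.comp_apply]
  exact (UnitaryGroup.localPiEquiv E c (n + n) JD v).apply_symm_apply _

/-- `inlLoc` is continuous. [cite: GelbartRogawski1991, §3.1 Prop. 3.1.1 p. 455 L1–3] -/
theorem continuous_inlLoc : Continuous (inlLoc F E c v n hJ hJD) :=
  ((UnitaryGroup.localPiEquiv E c (n + n) JD v).symm.continuous.comp (continuous_inlLocal F E c v n hJ hJD)).comp
    (UnitaryGroup.localPiEquiv E c n J v).continuous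

/-- **components of `g ⊕ 1`**: `(inlLoc g)_w = reindex e₂ e₂ (g_w ⊕ 1)` in `GL_{n+n}(E_w)` for every `w ∣ v`.
[cite: GelbartRogawski1991, §3.1 Prop. 3.1.1 p. 455 L1–3] -/
theorem inlLoc_apply (g : UnitaryGroup.localPi E c n J v) (w : UnitaryGroup.PlacesOver E v) :
    ((inlLoc F E c v n hJ hJD g : UnitaryGroup.localPi E c (n + n) JD v) : UnitaryGroup.LocalGLPi E (n + n) v) w =
      UnitaryGroup.reindexGL (e₂ n) (UnitaryGroup.blockDiagGL ((g : UnitaryGroup.LocalGLPi E n v) w, 1)) := by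
  refine Units.ext ?_
  rw [show inlLoc F E c v n hJ hJD g = (UnitaryGroup.localPiEquiv E c (n + n) JD v).symm
      (inlLocal F E c v n hJ hJD (UnitaryGroup.localPiEquiv E c n J v g)) from rfl,
    UnitaryGroup.coe_localPiEquiv_symm_apply, GLn.coe_piEquiv_apply, coe_inlLocal, UnitaryGroup.coe_reindexGL,
    UnitaryGroup.coe_blockDiagGL, UnitaryGroup.reindex_map, Matrix.fromBlocks_map, UnitaryGroup.coe_localPiEquiv_apply,
    GLn.map_piEquiv_symm, UnitaryGroup.coe_reindexGL, UnitaryGroup.coe_blockDiagGL, Units.val_one,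
    Matrix.map_zero _ (map_zero _), Matrix.map_one _ (map_zero _) (map_one _)]
  rfl

/-- entries of `reindex e₂ e₂ (A ⊕ 1)` lie in a subring containing the entries of `A`. [cite: GelbartRogawski1991, §3.1 (3.1.3) p. 456] -/
theorem reindex_fromBlocks_one_apply_mem {R : Type*} [Ring R] (S : Subring R) {A : Matrix (Fin n) (Fin n) R}
    (hA : ∀ i j, A i j ∈ S) (i j : Fin (n + n)) :
    Matrix.reindex (e₂ n) (e₂ n) (Matrix.fromBlocks A 0 0 (1 : Matrix (Fin n) (Fin n) R)) i j ∈ S := by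
  rw [Matrix.reindex_apply, Matrix.submatrix_apply]
  rcases (e₂ n).symm i with i' | i' <;> rcases (e₂ n).symm j with j' | j'
  · rw [Matrix.fromBlocks_apply₁₁]; exact hA i' j'
  · rw [Matrix.fromBlocks_apply₁₂]; exact S.zero_mem
  · rw [Matrix.fromBlocks_apply₂₁]; exact S.zero_mem
  · rw [Matrix.fromBlocks_apply₂₂]
    by_cases h : i' = j'
    · rw [h, Matrix.one_apply_eq]; exact S.one_mem
    · rw [Matrix.one_apply_ne h]; exact S.zero_mem

/-- **`g ⊕ 1` is integral when `g` is**: `inlLoc` carries `U(J)(𝒪_v)` into `U(J^𝔻)(𝒪_v)`.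
[cite: GelbartRogawski1991, §3.1 (3.1.3) p. 456] -/
theorem inlLoc_mem_localInt {k : UnitaryGroup.localPi E c n J v} (hk : k ∈ UnitaryGroup.localInt E c n J v) :
    inlLoc F E c v n hJ hJD k ∈ UnitaryGroup.localInt E c (n + n) JD v := by
  rw [UnitaryGroup.mem_localInt_iff] at hk ⊢
  intro w
  have hw := (mem_glInt_iff _).1 (hk w)
  rw [inlLoc_apply, mem_glInt_iff]
  refine ⟨fun i j => ?_, fun i j => ?_⟩
  · rw [UnitaryGroup.coe_reindexGL, UnitaryGroup.coe_blockDiagGL, Units.val_one]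
    exact reindex_fromBlocks_one_apply_mem n _ (fun i j => hw.1 i j) i j
  · rw [← map_inv, ← map_inv, Prod.inv_mk, inv_one, UnitaryGroup.coe_reindexGL, UnitaryGroup.coe_blockDiagGL, Units.val_one]
    exact reindex_fromBlocks_one_apply_mem n _ (fun i j => hw.2 i j) i j

/-! ## §2 `ι^𝔻_v (g ⊕ 1) = ι_v(g) ⊕ 1` -/

variable [Algebra.IsQuadraticExtension F E] {δ : E} (hcδ : c δ = -δ) (hδ : δ ≠ 0) {d : F} (hd : δ * δ = algebraMap F E d)
  (hT₀ : T₀.IsSymm) (hT₀d : IsUnit T₀.det)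

/-- **the embedding of the doubled group restricted to `U(T₀) × 1` is `spInl (e₂ n)` of the embedding of `U(T₀)`**:
`ι^𝔻_v(g ⊕ 1) = ι_v(g) ⊕ 1` in `Sp(𝕎_v ⊕ 𝕎⁻_v)` (`Res(g ⊕ 1) = Res g ⊕ Res 1`, relabelled by `e₂`).
[cite: GelbartRogawski1991, §3.1 Prop. 3.1.1 p. 455 L1–3] -/
theorem iota_inlLoc (g : UnitaryGroup.localPi E c n J v) :
    iota F E c (n + n) hcδ hδ hd (gramD F n T₀) (gramD_isSymm F n hT₀) hJD v (inlLoc F E c v n hJ hJD g) =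
      spInl (e₂ n) (localGram F n T₀ v) (-(localGram F n T₀ v)) (localGram_gramD F v n T₀) (iota F E c n hcδ hδ hd T₀ hT₀ hJ v g) := by
  rw [iota_def, iota_def]
  refine Subtype.ext ?_
  change (UnitaryGroup.isQuadraticCoordinates_local E v c hcδ hδ hd).resAut (Fin (n + n))
      ((UnitaryGroup.localPiEquiv E c (n + n) JD v (inlLoc F E c v n hJ hJD g) : UnitaryGroup.«local» E c (n + n) JD v) :
        GL (Fin (n + n)) (UnitaryGroup.LocalRing E v)) =
    inlW (e₂ n) ((UnitaryGroup.isQuadraticCoordinates_local E v c hcδ hδ hd).resAut (Fin n)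
      ((UnitaryGroup.localPiEquiv E c n J v g : UnitaryGroup.«local» E c n J v) : GL (Fin n) (UnitaryGroup.LocalRing E v)))
  rw [localPiEquiv_inlLoc, coe_inlLocal, (UnitaryGroup.isQuadraticCoordinates_local E v c hcδ hδ hd).resAut_reindexGL,
    (UnitaryGroup.isQuadraticCoordinates_local E v c hcδ hδ hd).resAut_blockDiagGL, inlW_eq_reindexW_spSumEquiv]
  simp only [map_one]

/-! ## §3 Undoubling a splitting of the doubled group -/

/-- `det (−T₀ ⊗ F_v)` is a unit. [cite: HarrisKudlaSweet1996, §1 (1.9)] -/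
theorem isUnit_det_localGram_neg (hT₀d : IsUnit T₀.det) : IsUnit (-(localGram F n T₀ v)).det := by
  rw [Matrix.det_neg]
  exact ((isUnit_one.neg).pow _).mul (UnitaryGroup.isUnit_det_map (algebraMap F Fv) hT₀d)

/-- `1_{𝒪_v^{n+n}} = 1_{𝒪_v^n} ⊠ 1_{𝒪_v^n}` along `e₂`. [cite: GelbartRogawski1991, §3.1 (3.1.3) p. 456] -/
theorem unitVec_eq_boxSB :
    unitVec F (Fin (n + n)) v = boxSB Fv (e₂ n) (unitVec F (Fin n) v) (unitVec F (Fin n) v) := by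
  apply Subtype.ext
  funext x
  rw [coe_boxSB, coe_unitVec, coe_unitVec]
  dsimp only
  have h : x ∈ integralBox F (Fin (n + n)) v ↔
      resL (e₂ n) x ∈ integralBox F (Fin n) v ∧ resR (e₂ n) x ∈ integralBox F (Fin n) v := by
    simp only [integralBox, Set.mem_univ_pi]
    exact forall_coord_iff (e₂ n) (Q := fun _ y => y ∈ (v.adicCompletionIntegers F : Set Fv)) x
  by_cases h₁ : resL (e₂ n) x ∈ integralBox F (Fin n) v
  · by_cases h₂ : resR (e₂ n) x ∈ integralBox F (Fin n) v
    · rw [Set.indicator_of_mem (h.2 ⟨h₁, h₂⟩), Set.indicator_of_mem h₁, Set.indicator_of_mem h₂, mul_one]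
    · rw [Set.indicator_of_notMem (fun hx => h₂ (h.1 hx).2), Set.indicator_of_notMem h₂, mul_zero]
  · rw [Set.indicator_of_notMem (fun hx => h₁ (h.1 hx).1), Set.indicator_of_notMem h₁, zero_mul]

variable (s : UnitaryGroup.localPi E c (n + n) JD v →* LocalMp F (n + n) (gramD F n T₀) v)
  (hs : ∀ g, MpPsi.proj _ (s g) = iota F E c (n + n) hcδ hδ hd (gramD F n T₀) (gramD_isSymm F n hT₀) hJD v g)

include hT₀ hs in
/-- `s ∘ inlLoc` lies over `spInl ∘ ι_v`. [cite: GelbartRogawski1991, §3.1 Prop. 3.1.1 p. 455 L1–3] -/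
theorem proj_comp_inlLoc (g : UnitaryGroup.localPi E c n J v) :
    MpPsi.proj (schrodingerSB (Matrix.toLinearMap₂' Fv (localGram F (n + n) (gramD F n T₀) v)) (adeleAddCharAt F v)
        (isLocallyConstant_of_isContinuousNontrivial (isContinuousNontrivial_adeleAddCharAt F v))
        (continuous_toLinearMap₂'_left (localGram F (n + n) (gramD F n T₀) v)))
      ((s.comp (inlLoc F E c v n hJ hJD)) g) =
      spInl (e₂ n) (localGram F n T₀ v) (-(localGram F n T₀ v)) (localGram_gramD F v n T₀)
        (iota F E c n hcδ hδ hd T₀ hT₀ hJ v g) :=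
  (hs (inlLoc F E c v n hJ hJD g)).trans (iota_inlLoc F E c v n hJ hJD hcδ hδ hd hT₀ g)

/-- **UNDOUBLING AT `v`**: a homomorphism `s : U(J^𝔻)(F_v) →* S̃p(𝕎^𝔻_v)` over `ι^𝔻_v` restricts-and-strips to
`undoubleLoc s : U(J)(F_v) →* S̃p(𝕎_v)` (the tree's `undouble` at `s ∘ inlLoc` over `spInl ∘ ι_v`).
[cite: GelbartRogawski1991, §3.1 Prop. 3.1.1 p. 455 L1–3] -/
def undoubleLoc : UnitaryGroup.localPi E c n J v →* LocalMp F n T₀ v :=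
  undouble (e₂ n) (localGram F n T₀ v) (-(localGram F n T₀ v)) (localGram_gramD F v n T₀)
    (isUnit_det_localGram_neg F v n hT₀d)
    hlv hψv (continuous_toLinearMap₂'_left (localGram F n T₀ v))
    (continuous_toLinearMap₂'_left (-(localGram F n T₀ v)))
    (continuous_toLinearMap₂'_left (localGram F (n + n) (gramD F n T₀) v))
    (iota F E c n hcδ hδ hd T₀ hT₀ hJ v) (s.comp (inlLoc F E c v n hJ hJD))
    (proj_comp_inlLoc F E c v n hJ hJD hcδ hδ hd hT₀ s hs)

/-- **`undoubleLoc s` lies over `ι_v`**: `π(undoubleLoc s g) = ι_v(g)`. [cite: GelbartRogawski1991, §3.1 Prop. 3.1.1 p. 455 L1–3] -/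
theorem proj_undoubleLoc (g : UnitaryGroup.localPi E c n J v) :
    MpPsi.proj _ (undoubleLoc F E c v n hJ hJD hcδ hδ hd hT₀ hT₀d s hs g) = iota F E c n hcδ hδ hd T₀ hT₀ hJ v g :=
  proj_undouble (e₂ n) (localGram F n T₀ v) (-(localGram F n T₀ v)) (localGram_gramD F v n T₀)
    (isUnit_det_localGram_neg F v n hT₀d) hlv hψv (continuous_toLinearMap₂'_left (localGram F n T₀ v))
    (continuous_toLinearMap₂'_left (-(localGram F n T₀ v)))
    (continuous_toLinearMap₂'_left (localGram F (n + n) (gramD F n T₀) v))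
    (iota F E c n hcδ hδ hd T₀ hT₀ hJ v) (s.comp (inlLoc F E c v n hJ hJD))
    (proj_comp_inlLoc F E c v n hJ hJD hcδ hδ hd hT₀ s hs) g

/-- **`ω(s(g ⊕ 1))(f₁ ⊠ f₂) = ω(undoubleLoc s g) f₁ ⊠ f₂`.** [cite: MoeglinVignerasWaldspurger1987, Chap. 2 II.1 Rem. (6)] -/
theorem toRep_undoubleLoc_boxSB (g : UnitaryGroup.localPi E c n J v) (f₁ : SchwartzBruhat (Fin n → Fv))
    (f₂ : SchwartzBruhat (Fin n → Fv)) :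
    MpPsi.toRep (localSchrodinger F (n + n) (gramD F n T₀) v) (s (inlLoc F E c v n hJ hJD g)) (boxSB Fv (e₂ n) f₁ f₂) =
      boxSB Fv (e₂ n) (MpPsi.toRep (localSchrodinger F n T₀ v)
        (undoubleLoc F E c v n hJ hJD hcδ hδ hd hT₀ hT₀d s hs g) f₁) f₂ :=
  toRep_apply_boxSB_undouble (e₂ n) (localGram F n T₀ v) (-(localGram F n T₀ v)) (localGram_gramD F v n T₀)
    (isUnit_det_localGram_neg F v n hT₀d) hlv hψv (continuous_toLinearMap₂'_left (localGram F n T₀ v))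
    (continuous_toLinearMap₂'_left (-(localGram F n T₀ v)))
    (continuous_toLinearMap₂'_left (localGram F (n + n) (gramD F n T₀) v))
    (iota F E c n hcδ hδ hd T₀ hT₀ hJ v) (s.comp (inlLoc F E c v n hJ hJD))
    (proj_comp_inlLoc F E c v n hJ hJD hcδ hδ hd hT₀ s hs) g f₁ f₂

include hs in
/-- **smooth vectors transfer**: if `s(k)` fixes `f₁ ⊠ f₂` for `k` in an open subgroup of `H(F_v)` (`f₂ ≠ 0`), then
`undoubleLoc s k` fixes `f₁` for `k` in an open subgroup of `U(J)(F_v)` (the preimage under the continuous `inlLoc`).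
[cite: MoeglinVignerasWaldspurger1987, Chap. 2 II.8] -/
theorem exists_open_forall_toRep_undoubleLoc_eq (f₁ : SchwartzBruhat (Fin n → Fv)) {f₂ : SchwartzBruhat (Fin n → Fv)}
    (hf₂ : f₂ ≠ 0)
    (h : ∃ U : Subgroup (UnitaryGroup.localPi E c (n + n) JD v), IsOpen (U : Set (UnitaryGroup.localPi E c (n + n) JD v)) ∧
      ∀ k ∈ U, MpPsi.toRep (localSchrodinger F (n + n) (gramD F n T₀) v) (s k) (boxSB Fv (e₂ n) f₁ f₂) = boxSB Fv (e₂ n) f₁ f₂) :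
    ∃ U : Subgroup (UnitaryGroup.localPi E c n J v), IsOpen (U : Set (UnitaryGroup.localPi E c n J v)) ∧
      ∀ k ∈ U, MpPsi.toRep (localSchrodinger F n T₀ v) (undoubleLoc F E c v n hJ hJD hcδ hδ hd hT₀ hT₀d s hs k) f₁ = f₁ := by
  obtain ⟨U, hU, hfix⟩ := h
  refine ⟨U.comap (inlLoc F E c v n hJ hJD), hU.preimage (continuous_inlLoc F E c v n hJ hJD), fun k hk => ?_⟩
  refine boxSB_left_cancel Fv (e₂ n) hf₂ ?_
  rw [← toRep_undoubleLoc_boxSB]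
  exact hfix _ (Subgroup.mem_comap.1 hk)

include hs in
/-- **the unramified vector transfers**: if `ω(s k)` fixes `1_{𝒪_v^{n+n}}` for all `k ∈ H(𝒪_v)`, then
`ω(undoubleLoc s k)` fixes `1_{𝒪_v^n}` for all `k ∈ U(J)(𝒪_v)`. [cite: GelbartRogawski1991, §3.1 (3.1.3) p. 456] -/
theorem toRep_undoubleLoc_unitVec
    (h : ∀ k ∈ UnitaryGroup.localInt E c (n + n) JD v,
      MpPsi.toRep (localSchrodinger F (n + n) (gramD F n T₀) v) (s k) (unitVec F (Fin (n + n)) v) = unitVec F (Fin (n + n)) v)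
    (k : UnitaryGroup.localPi E c n J v) (hk : k ∈ UnitaryGroup.localInt E c n J v) :
    MpPsi.toRep (localSchrodinger F n T₀ v) (undoubleLoc F E c v n hJ hJD hcδ hδ hd hT₀ hT₀d s hs k) (unitVec F (Fin n) v) =
      unitVec F (Fin n) v := by
  have hne : unitVec F (Fin n) v ≠ 0 := fun h0 => by
    have h1 : ((unitVec F (Fin n) v : SchwartzBruhat (Fin n → Fv)) : (Fin n → Fv) → ℂ) 0 = 1 :=
      unitVec_apply_of_mem fun i _ => (v.adicCompletionIntegers F).zero_mem
    rw [h0, ZeroMemClass.coe_zero, Pi.zero_apply] at h1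
    exact zero_ne_one h1
  refine boxSB_left_cancel Fv (e₂ n) hne ?_
  rw [← toRep_undoubleLoc_boxSB, ← unitVec_eq_boxSB]
  exact h _ (inlLoc_mem_localInt F E c v n hJ hJD hk)

/-! ### Build-lane note (ops-buildfix G11b-3 recipe, as in the sibling GelbartRogawski1991 files): the public theorems are tagged
`[implicit_reducible]` purely to keep their large binder telescopes out of Lean's library-suggestion index at `lean -o`;
inert for the kernel, no statement or proof is changed. -/
set_option allowUnsafeReducibility true in
attribute [implicit_reducible]
  local_eq
  local_doubled_eq
  coe_inlLocal
  continuous_inlLocal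
  localPiEquiv_inlLoc
  continuous_inlLoc
  inlLoc_apply
  reindex_fromBlocks_one_apply_mem
  inlLoc_mem_localInt
  iota_inlLoc
  isUnit_det_localGram_neg
  unitVec_eq_boxSB
  proj_comp_inlLoc
  proj_undoubleLoc
  toRep_undoubleLoc_boxSB
  exists_open_forall_toRep_undoubleLoc_eq
  toRep_undoubleLoc_unitVec

end Literature.NumberTheory.GelbartRogawski1991.UnitaryDualPair.LocalSplitting

end
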